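import Summits.Ventures.LatticeQCDFlow.Scaling.FlowLadderWilsonFloor
import Summits.Ventures.LatticeQCDFlow.Scaling.HomLadderMixingCeiling

/-!
HONEST FRAMING: exact (Metropolis-corrected) sampling algorithms for lattice gauge theory; figures
of merit are autocorrelation/cost numbers at stated couplings and volumes; no continuum-physics
claim.

# FlowLadderMixingLaw — THE MAP-ASSISTED LADDER WITH PERFECT ADJACENT TRANSPORTS IS `Θ((K³/t)·log K)` TWO-SIDED: FOR `ptFlowSampler t μ M φ` WITH `μ_{j+1}∘φ_j = μ_j`,
# ARBITRARY COLD LAWS, AN EXACT HOT SAMPLER AND IDLE COLD KERNELS,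
# **`(K(2K+1)²/(π²t) − 1)·(½·log(K+1) − log(24√5)) ≤ t_mix(1/4) ≤ ⌈max{K(2K+1)²/t, π²(K+1)²/(2√2(1−t))}·log(4√2K(K+1)(2K+1)/t)⌉`** (lean-2 GEN-47, ours)

Venture-side (OURS).  Cell `lqcd-flow` (pub-lqcd), unit `pub-lqcd-lean-2-g47`, 2026-08-31.  Chapter AG, file 10 — the ceiling of file 9 carried to the flow ladder of chapters F ∕ I by the conjugacy of
file 4 (`flowLadder_mixingTime_eq`: in level coordinates the flow ladder with perfect adjacent transports IS chapter R's `ptBareSampler` with one law `μ_0` at every level, an exact hot sampler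
and idle cold kernels, and a bijective relabelling preserves mixing times).  No definitions.

* **`flowLadderPerfect_mixingTime_le_of_levelMaps`**, **`flowLadderPerfect_mixingTime_le`** — `t_mix(ε) ≤ ⌈max{K(2K+1)²/t, π²(K+1)/(2√2(1−t)/(K+1))}·log(√2K(K+1)(2K+1)/(tε))⌉`
  (`K ≥ 1`, `0 < t < 1`, `μ_0 > 0` a probability vector, `μ_{j+1}(φ_ju) = μ_j(u)`);
* **`flowLadderPerfect_mixingTime_two_sided`** — with file 4's floor (`K ≥ 2`, some `μ_0(u) ≤ ½`).

Reading (no numerics implied): the best a learned family of adjacent transports can do for the replica-exchange LADDER — remove every rejection — leaves a sampler that mixes in `Θ((K³/t)·log K)`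
steps from both sides; chapter L ∕ M's hub with the same perfect transports is `Θ(K·log K)`.  The venture's figure of merit for flows on a ladder is therefore bounded by topology before map
quality enters.  NOT CLAIMED: imperfect transports; non-idle cold kernels (they only help the constants of the ceiling's hot term, not typed).  Literature grade (cell rule): OWN COROLLARY of
AG4 + AG9; nothing cited; no new bib keys.
-/

noncomputable section

open Finset Function Real
open Literature.Probability.MarkovChains

namespace Summit.Ventures.LatticeQCDFlow.Scaling

variable {S : Type*} [Fintype S] [DecidableEq S] {K : ℕ} {μ : Fin (K + 1) → S → ℝ} {M : Fin (K + 1) → S → S → ℝ} {t : ℝ}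

section LevelMaps
variable (L : Fin (K + 1) → Equiv.Perm S)

/-- **THE CEILING IN LEVEL COORDINATES:** `L_0 = 1`, `μ_i∘L_i⁻¹ = μ_0` for every level, `μ_0 > 0` a probability vector, exact hot sampler, idle cold kernels, `K ≥ 1`, `0 < t < 1`, `ε > 0` ⇒
`t_mix(ptFlowSampler t μ M φ^L; ε) ≤ ⌈max{K(2K+1)²/t, π²(K+1)/(2√2(1−t)/(K+1))}·log(√2K(K+1)(2K+1)/(tε))⌉`. [ours] -/
theorem flowLadderPerfect_mixingTime_le_of_levelMaps (hL0 : L 0 = Equiv.refl S) (hK : 1 ≤ K) (hμ0 : ∀ v, 0 < μ 0 v) (hμ01 : ∑ v, μ 0 v = 1)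
    (hM0 : ∀ u v, M 0 u v = μ 0 v) (hidle : ∀ i : Fin K, ∀ u v, M i.succ u v = if v = u then 1 else 0) (ht0 : 0 < t) (ht1 : t < 1)
    (hperf : ∀ (i : Fin (K + 1)) (u : S), μ i ((L i).symm u) = μ 0 u) {ε : ℝ} (hε : 0 < ε) :
    mixingTime (ptFlowSampler t μ M (fun j : Fin K => (L j.castSucc).trans (L j.succ).symm)) (tensorFun μ) ε
      ≤ ⌈max ((K : ℝ) * (2 * K + 1) ^ 2 / t) (π ^ 2 * ((K : ℝ) + 1) / (2 * Real.sqrt 2 * ((1 - t) * ((1 : ℝ) / (K + 1)))))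
          * Real.log (Real.sqrt 2 * K * ((K : ℝ) + 1) * (2 * K + 1) / (t * ε))⌉₊ := by
  rw [flowLadder_mixingTime_eq L t μ M]
  have hν : (fun (i : Fin (K + 1)) (u : S) => μ i ((L i).symm u)) = fun _ : Fin (K + 1) => μ 0 := funext fun i => funext fun u => hperf i u
  rw [hν]
  exact ptBareSampler_hom_mixingTime_le (M := fun i u v => M i ((L i).symm u) ((L i).symm v)) hK ht0 ht1 hμ0 hμ01
    (relabelLadder_hotSampler L hL0 hM0) (relabelLadder_idle L hidle) hε

end LevelMaps

/-- **THE CEILING WITH PERFECT ADJACENT TRANSPORTS:** maps with `μ_{j+1}(φ_ju) = μ_j(u)` (every flow swap accepted), arbitrary cold laws, `μ_0 > 0` a probability vector, exact hot sampler,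
idle cold kernels, `K ≥ 1`, `0 < t < 1`, `ε > 0` ⇒ **`t_mix(ptFlowSampler t μ M φ; ε) ≤ ⌈max{K(2K+1)²/t, π²(K+1)/(2√2(1−t)/(K+1))}·log(√2K(K+1)(2K+1)/(tε))⌉`**. [ours] -/
theorem flowLadderPerfect_mixingTime_le (φ : Fin K → Equiv.Perm S) (hK : 1 ≤ K) (hμ0 : ∀ v, 0 < μ 0 v) (hμ01 : ∑ v, μ 0 v = 1)
    (hM0 : ∀ u v, M 0 u v = μ 0 v) (hidle : ∀ i : Fin K, ∀ u v, M i.succ u v = if v = u then 1 else 0) (ht0 : 0 < t) (ht1 : t < 1)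
    (hperfect : ∀ (j : Fin K) (u : S), μ j.succ (φ j u) = μ j.castSucc u) {ε : ℝ} (hε : 0 < ε) :
    mixingTime (ptFlowSampler t μ M φ) (tensorFun μ) ε
      ≤ ⌈max ((K : ℝ) * (2 * K + 1) ^ 2 / t) (π ^ 2 * ((K : ℝ) + 1) / (2 * Real.sqrt 2 * ((1 - t) * ((1 : ℝ) / (K + 1)))))
          * Real.log (Real.sqrt 2 * K * ((K : ℝ) + 1) * (2 * K + 1) / (t * ε))⌉₊ := by
  obtain ⟨L, hL0, hLφ⟩ := exists_levelMaps φ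
  have hφ : φ = fun j : Fin K => (L j.castSucc).trans (L j.succ).symm := (funext hLφ).symm
  have hstep : ∀ (j : Fin K) (u : S), (L j.succ).symm u = φ j ((L j.castSucc).symm u) := by
    intro j u
    have h := Equiv.ext_iff.mp (hLφ j) ((L j.castSucc).symm u)
    simp only [Equiv.trans_apply, Equiv.apply_symm_apply] at h
    exact h
  have hperf : ∀ (i : Fin (K + 1)) (u : S), μ i ((L i).symm u) = μ 0 u := by
    intro i
    induction i using Fin.induction with
    | zero => intro u; rw [hL0]; rfl
    | succ j ih => intro u; rw [hstep j u, hperfect j, ih]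
  rw [hφ]
  exact flowLadderPerfect_mixingTime_le_of_levelMaps L hL0 hK hμ0 hμ01 hM0 hidle ht0 ht1 hperf hε

/-- **THE FLOW LADDER WITH PERFECT ADJACENT TRANSPORTS IS `Θ((K³/t)·log K)`, BOTH SIDES:** `K ≥ 2`, `0 < t < 1`, `μ_{j+1}∘φ_j = μ_j`, `μ_0 > 0` a probability vector with some `μ_0(u) ≤ ½`, exact
hot sampler, idle cold kernels:
**`(K(2K+1)²/(π²t) − 1)·(½·log(K+1) − log(24√5)) ≤ t_mix(1/4) ≤ ⌈max{K(2K+1)²/t, π²(K+1)/(2√2(1−t)/(K+1))}·log(4√2K(K+1)(2K+1)/t)⌉`**. [ours] -/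
theorem flowLadderPerfect_mixingTime_two_sided (φ : Fin K → Equiv.Perm S) (hK : 2 ≤ K) (hμ0 : ∀ v, 0 < μ 0 v) (hμ01 : ∑ v, μ 0 v = 1)
    (hM0 : ∀ u v, M 0 u v = μ 0 v) (hidle : ∀ i : Fin K, ∀ u v, M i.succ u v = if v = u then 1 else 0) (ht0 : 0 < t) (ht1 : t < 1)
    (hperfect : ∀ (j : Fin K) (u : S), μ j.succ (φ j u) = μ j.castSucc u) (u : S) (hu : μ 0 u ≤ 1 / 2) :
    ((K : ℝ) * (2 * K + 1) ^ 2 / (π ^ 2 * t) - 1) * (Real.log ((K : ℝ) + 1) / 2 - Real.log (24 * Real.sqrt 5))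
        ≤ (mixingTime (ptFlowSampler t μ M φ) (tensorFun μ) (1 / 4) : ℝ)
      ∧ mixingTime (ptFlowSampler t μ M φ) (tensorFun μ) (1 / 4)
        ≤ ⌈max ((K : ℝ) * (2 * K + 1) ^ 2 / t) (π ^ 2 * ((K : ℝ) + 1) / (2 * Real.sqrt 2 * ((1 - t) * ((1 : ℝ) / (K + 1)))))
            * Real.log (Real.sqrt 2 * K * ((K : ℝ) + 1) * (2 * K + 1) / (t * (1 / 4)))⌉₊ :=
  ⟨flowLadderPerfect_mixingTime_ge φ hK hμ0 hμ01 hM0 hidle ht0 ht1 hperfect u hu,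
    flowLadderPerfect_mixingTime_le φ (by omega) hμ0 hμ01 hM0 hidle ht0 ht1 hperfect (by norm_num)⟩

end Summit.Ventures.LatticeQCDFlow.Scaling

end
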